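import Summits.ResolutionOfSingularities.ResolutionOfSingularities.Theorems.DescentDescentPerfectToAllExhaustion
import Summits.ResolutionOfSingularities.ResolutionOfSingularities.Theorems.DescentDescentPerfectToAllResidualWitnessCountable
import HarnessLib

/-!
# `DescentPerfectToAll` (stmt-ResolutionOfSingularities-0549) — lens 4 («uniformity / ultraproduct
conditional bridge»), generation 2: a TYPED NO-GO, not a line

Unit `res-B-lens-4-g2` (planner). OURS; nothing here is a statement of any manuscript, nothing here
proves resolution of singularities in characteristic `p`, and nothing here decides the crux.
Companion memo (full proofs of the sorried statements, models, consequences):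
`Cruxes/DescentPerfectToAll/OBSTRUCTION-lens4-no-separable-envelope.md`.

## What is typed

The tree reduces the crux to its RESIDUAL class (`descentPerfectToAll_iff_residual`,
`Theorems/DescentDescentPerfectToAllExhaustion.lean`): countable fields `k` of characteristic `p` that
are NOT «EFT-separably exhausted» — there is a finite `s ⊆ k` such that no subfield `E ∋ s` that is
essentially of finite type over a perfect field has `k/E` separable (Mac Lane). Every
transfer / uniformity / ultraproduct / envelope argument for the residual class («resolve `X ⊗ₖ L` over
a cleverly chosen OVER-field `L ⊇ k` by the tree's tower mechanism, then DESCEND to `k`» — Łoś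
ultrapowers, elementary or existential transfer, Ershov/SCF prime models (gen 0's dead line
`via_ershov_transfer`), large/henselian envelopes, `D`-generic specialisation) needs an over-field `L`
that IS exhausted at (the image of) `s`.

* `ExhaustedAt p L S` — the tree's residual binder at a fixed finite set (verbatim shape).
* `DigitClosed p t F`, `digitHull p t s` — the `t`-DIGIT HULL of `s` in `K`: the smallest subfield
  containing `t, s` and closed under taking `t`-digits (`x = ∑ᵢ tⁱ dᵢᵖ ⇒ dᵢ ∈ F`), i.e. the field
  generated by the orbit of `s` under the Cartier operators attached to `t`.
* `not_exhaustedAt_extension_of_digitHull` (O1, **NoSeparableTowerEnvelope**): if the digit hull of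
  `s` has infinite transcendence degree, then NO extension `ι : K →+* L` in which `t` stays a
  non-`p`-th power is exhausted at `{ι t, ι s}`. Hence every over-field of such a `K` that the tree's
  mechanism can resolve over is an INSEPARABLE extension of `K` (`t ∈ Lᵖ`) — the catalogued barrier
  `Literature.Barriers.ResolutionOfSingularities.InseparableBaseChangeResolution` /
  `RegularNotGeometricallyRegular` (Disproof.lean §3: `not_resolutionBaseChanges`, `not_regular_stable`,
  `not_regular_ascends_pointwise`) then stands between `L` and `K`.
* `exists_laurentSeries_digitHull` (O2): `𝔽ₚ((X))` contains (Baire-generic) `s` whose `X`-digit hull has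
  infinite transcendence degree; `laurentSeries_no_separable_exhausted_extension` (O3, PROVED from O1+O2):
  the flagship residual field `𝔽ₚ((X))` — and (O3') its countable digit-closed subfields, which are in
  the crux's countable residual class — admit no separable exhausted over-field at all.
* `exists_laurentSeries_tame_digitHull` (O5): TAME residual fields exist — the modular residual field
  `digitHull p q (θ₃⁴ mod p)` has transcendence degree `2` (Katz's mod-`p` modular forms / Igusa tower absorb all
  decimations), so (O1) does not cover the whole residual class — but (O6) below does, in `p`-rank one.
* `not_exhaustedAt_extension_of_pRankOne` (O6) and
  `laurentSeries_no_separable_exhausted_extension_of_transcendental` (O6'): in `p`-rank ONE residualness is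
  ABSOLUTE under extensions keeping `t ∉ Lᵖ` — no digit genericity needed (Hasse–Schmidt «no new constants»);
  this answers the envelope question for tame fields (Q-env-tame) in the NEGATIVE and supersedes O1/O3 on every
  `p`-rank-one `K`.
* `relation_over_perfectCore_of_existentiallyClosed` (O4, **EC-rigidity**): for the complementary «tame»
  case, if `K` is existentially closed in `L` for homogeneous Frobenius-linear systems, `[L : Lᵖ] ≤ p`,
  `t ∉ Lᵖ` and `L` is exhausted at `{ι t, ι s}`, then `s` satisfies a non-trivial polynomial relation with
  `t` whose coefficients lie in the perfect core `⋂ₙ K^{pⁿ}` — so an ultrapower / existential sandwich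
  reaches exactly the tree's class `T` (`exhaustedByEssFiniteType_iff_trdeg_le_of_pRank`), nothing new.

Intra-field facts already on record (`not_exhaustedByEssFiniteType_of_eq_macLaneField`,
`exists_countable_digitClosed_subfield_laurentSeries`, Cruxes note c6) only exclude exhausting LEVELS
`E ≤ k`; (O1) excludes exhausting OVER-fields, which is what a transfer line needs.

Sorries: O1, O2, O3', O4, O5, O6, O6' (paper proofs in the memo, §2–§4, §7, §7b). Proved here: shape lemmas and O3.
-/

set_option linter.dupNamespace false
set_option linter.unusedSectionVars false

open scoped LaurentSeries

namespace Summit.ResolutionOfSingularities.ResolutionOfSingularities.Cruxes.DescentPerfectToAll.Lens4NoSeparableEnvelope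

variable (p : ℕ) [Fact p.Prime]

/-- «`L` is EFT-separably exhausted at the set `S`»: there is a subfield `E ⊇ S` of `L`, essentially of
finite type over a perfect field `k₀`, with `L/E` separable in Mac Lane's form (`E`-linearly independent
finite families stay independent after `x ↦ xᵖ`). This is the tree's residual binder
(`hasResolution_of_perfectRes_of_exhaustedByEssFiniteType`, hypothesis `hk`, and
`descentPerfectToAll_iff_residual`) at ONE set `S` instead of `∀ s : Finset L`. -/
def ExhaustedAt (L : Type) [Field L] (S : Set L) : Prop :=
  ∃ (k₀ : Type) (_ : Field k₀) (_ : PerfectField k₀) (E : Subfield L) (_ : Algebra k₀ E),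
    Algebra.EssFiniteType k₀ E ∧ S ⊆ E ∧
      ∀ u : Finset L, LinearIndepOn E _root_.id (↑u : Set L) →
        LinearIndepOn E (fun x : L => x ^ p) (↑u : Set L)

/-- Shape check: the tree's «exhausted» hypothesis (the binder `hk` of
`Theorems.hasResolution_of_perfectRes_of_exhaustedByEssFiniteType`; lens 6's `EFTSeparablyExhausted p L` in
`Cruxes/DescentPerfectToAll/NegationLens6.lean` is the same text) is `∀ s : Finset L, ExhaustedAt p L ↑s`. -/
theorem forall_exhaustedAt_iff {L : Type} [Field L] :
    (∀ S : Finset L, ExhaustedAt p L (↑S : Set L)) ↔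
      ∀ s : Finset L, ∃ (k₀ : Type) (_ : Field k₀) (_ : PerfectField k₀) (E : Subfield L)
        (_ : Algebra k₀ E), Algebra.EssFiniteType k₀ E ∧ (↑s : Set L) ⊆ E ∧
          ∀ u : Finset L, LinearIndepOn E _root_.id (↑u : Set L) →
            LinearIndepOn E (fun x : L => x ^ p) (↑u : Set L) :=
  Iff.rfl

/-- Hence a field with ONE non-exhausted pair is in the residual class (not exhausted). -/
theorem not_forall_exhaustedAt_of_pair {L : Type} [Field L] {a b : L}
    (h : ¬ ExhaustedAt p L {a, b}) : ¬ ∀ S : Finset L, ExhaustedAt p L (↑S : Set L) := by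
  classical
  intro hL
  apply h
  simpa using hL ({a, b} : Finset L)

/-- Monotonicity in the set: exhausted at `S` ⇒ exhausted at every `S' ⊆ S`. -/
theorem ExhaustedAt.mono {L : Type} [Field L] {S S' : Set L} (hS : S' ⊆ S)
    (h : ExhaustedAt p L S) : ExhaustedAt p L S' := by
  obtain ⟨k₀, hF, hP, E, hA, hEFT, hsub, hML⟩ := h
  exact ⟨k₀, hF, hP, E, hA, hEFT, hS.trans hsub, hML⟩

/-- A subfield `F ≤ K` is `t`-DIGIT-CLOSED: whenever an element of `F` is written in `t`-digits
`x = ∑_{i<p} tⁱ · dᵢᵖ` with `dᵢ ∈ K`, the digits lie in `F`. (When `{1, t, …, t^{p-1}}` is a `Kᵖ`-basis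
of `K` the digits are unique and `F ↦` «closed under the `p` Cartier operators `x ↦ dᵢ`».) -/
def DigitClosed {K : Type} [Field K] (t : K) (F : Subfield K) : Prop :=
  ∀ x ∈ F, ∀ d : Fin p → K, x = ∑ i : Fin p, t ^ (i : ℕ) * d i ^ p → ∀ i, d i ∈ F

/-- The `t`-DIGIT HULL of `s` in `K`: the smallest `t`-digit-closed subfield containing `t` and `s`
(an intersection of digit-closed subfields is digit-closed). Over `𝔽ₚ((X))` with `t = X` it is the field
generated over `𝔽ₚ(X)` by the `p`-kernel (all `pᴺ`-decimations of the coefficient sequence) of `s`;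
by Christol's theorem it is finitely generated by kernel elements iff `s` is algebraic. -/
def digitHull {K : Type} [Field K] (t s : K) : Subfield K :=
  sInf {F : Subfield K | t ∈ F ∧ s ∈ F ∧ DigitClosed p t F}

theorem mem_digitHull_left {K : Type} [Field K] (t s : K) : t ∈ digitHull p t s := by
  refine Subfield.mem_sInf.2 ?_
  rintro F ⟨ht, -, -⟩
  exact ht

theorem mem_digitHull_right {K : Type} [Field K] (t s : K) : s ∈ digitHull p t s := by
  refine Subfield.mem_sInf.2 ?_
  rintro F ⟨-, hs, -⟩
  exact hs

theorem digitClosed_digitHull {K : Type} [Field K] (t s : K) : DigitClosed p t (digitHull p t s) := by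
  intro x hx d hd i
  refine Subfield.mem_sInf.2 ?_
  rintro F ⟨ht, hs, hF⟩
  exact hF x (Subfield.mem_sInf.1 hx F ⟨ht, hs, hF⟩) d hd i

/-- «The digit hull of `s` has infinite transcendence degree over the prime field»: for every `N` it
contains `N` algebraically independent elements. -/
def DigitHullInfinite {K : Type} [Field K] [Algebra (ZMod p) K] (t s : K) : Prop :=
  ∀ N : ℕ, ∃ v : Fin N → K, (∀ i, v i ∈ digitHull p t s) ∧ AlgebraicIndependent (ZMod p) v

/-- **(O1) NoSeparableTowerEnvelope.** Let `ι : K →+* L` be an extension of fields of characteristic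
`p` in which `t` stays a non-`p`-th power (e.g. `L/K` separable and `t ∉ Kᵖ`), and let `s ∈ K` have a
`t`-digit hull of infinite transcendence degree. Then `L` is NOT EFT-separably exhausted at `{ι t, ι s}`.

Proof (memo §2). Suppose `E ≤ L`, `k₀` perfect, `E/k₀` essentially of finite type (hence a finitely
generated field extension), `ι t, ι s ∈ E`, `L/E` Mac Lane-separable. (1) `E/k₀` is separable and
finitely generated, so a `p`-basis `c̄` of `E` (absolute = over `k₀`) is a separating transcendence basis
[Matsumura, Thm 26.5–26.8]; `ι t ∉ Eᵖ` (else `ι t ∈ Lᵖ`), so choose `c̄ = (ι t, z̄)`. (2) `L/E` separable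
⇒ `c̄` stays `p`-independent in `L` [Thm 26.4/26.6], so `c̄`-digit expansions are UNIQUE in `L`.
(3) `ι s` is separably algebraic over `k₀(c̄)`; let `k₁ ⊆ k₀` be the perfect closure (inside the perfect
field `k₀`) of the prime field with the finitely many `k₀`-coefficients of its minimal polynomial
adjoined — a perfect field of finite transcendence degree — and `E₁ :=` the relative separable
algebraic closure of `k₁(c̄)` in `E`; then `ι t, ι s ∈ E₁` and `trdeg E₁ = trdeg k₁ + |c̄| < ∞`.
(4) `E₁ = E₁ᵖ(c̄)` (separable algebraic over `k₁(c̄)` with `k₁` perfect), so every `x ∈ E₁` has a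
`c̄`-digit expansion with digits in `E₁`. (5) `F := ι⁻¹(E₁) ≤ K` contains `t, s` and is `t`-digit-closed:
if `x ∈ F` and `x = ∑ tⁱ dᵢᵖ` with `dᵢ ∈ K`, then in `L` this is a `c̄`-digit expansion of `ι x` (all
`z̄`-exponents zero), which by uniqueness (2) coincides with the one of (4), so `ι dᵢ ∈ E₁`. Hence
`digitHull p t s ≤ F`, and `ι` maps algebraically independent families in the hull to algebraically
independent families in `E₁`, contradicting `trdeg E₁ < ∞`. ∎ -/
theorem not_exhaustedAt_extension_of_digitHull
    {K L : Type} [Field K] [Field L] [CharP K p] [CharP L p] [Algebra (ZMod p) K]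
    (ι : K →+* L) (t s : K) (ht : ∀ z : L, z ^ p ≠ ι t) (hH : DigitHullInfinite p t s) :
    ¬ ExhaustedAt p L {ι t, ι s} := by
  sorry

/-- **(O2) The flagship residual field has digit-generic elements.** In `𝔽ₚ((X))` (with `t = X`) there
is a power series `s` whose `X`-digit hull has infinite transcendence degree.

Proof (memo §3, Baire category). For `s = ∑ aₙ Xⁿ ∈ 𝔽ₚ[[X]]` the level-`N` digits are the `pᴺ`
decimations `s_{N,r} = ∑ₘ a_{m pᴺ + r} Xᵐ` (`0 ≤ r < pᴺ`), all in the hull, and `s ↦ (s_{N,r})_r` is a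
homeomorphism `𝔽ₚ[[X]] ≅ 𝔽ₚ[[X]]^{pᴺ}`. For a fixed non-zero `P ∈ 𝔽ₚ[X][Y₁,…,Y_{pᴺ}]` the set
`{P(s_{N,·}) = 0}` is closed and nowhere dense (a non-zero polynomial does not vanish on an open subset of
`𝔽ₚ[[X]]^{m}`, `𝔽ₚ[[X]]` being an infinite integral domain); there are countably many `(N, P)`, so a
comeagre set of `s` has, for every `N`, its `pᴺ` level-`N` digits algebraically independent over
`𝔽ₚ(X)`. (An abstract model: the free digit field `colim_N 𝔽ₚ(t)(x_w : w ∈ {0..p-1}ᴺ)`,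
`x_w ↦ ∑ᵢ tⁱ x_{wi}ᵖ`.) ∎ -/
theorem exists_laurentSeries_digitHull :
    ∃ s : (ZMod p)⸨X⸩, DigitHullInfinite p (HahnSeries.single (1 : ℤ) (1 : ZMod p)) s := by
  sorry

/-- **(O3) Corollary (PROVED from O1 + O2).** There is `s ∈ 𝔽ₚ((X))` such that NO extension
`ι : 𝔽ₚ((X)) →+* L` in which `X` stays a non-`p`-th power is EFT-separably exhausted at `{ι X, ι s}`:
every over-field of `𝔽ₚ((X))` over which the tree's tower mechanism
(`hasResolution_of_perfectRes_of_exhaustedByEssFiniteType`) resolves `X_K ⊗ L` for all `X_K` is an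
inseparable extension. -/
theorem laurentSeries_no_separable_exhausted_extension :
    ∃ s : (ZMod p)⸨X⸩, ∀ (L : Type) [Field L] [CharP L p] (ι : (ZMod p)⸨X⸩ →+* L),
      (∀ z : L, z ^ p ≠ ι (HahnSeries.single (1 : ℤ) (1 : ZMod p))) →
        ¬ ExhaustedAt p L {ι (HahnSeries.single (1 : ℤ) (1 : ZMod p)), ι s} := by
  haveI : CharP ((ZMod p)⸨X⸩) p :=
    charP_of_injective_algebraMap (algebraMap (ZMod p) ((ZMod p)⸨X⸩)).injective p
  obtain ⟨s, hs⟩ := exists_laurentSeries_digitHull p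
  exact ⟨s, fun L _ _ ι hι => not_exhaustedAt_extension_of_digitHull p ι _ s hι hs⟩

/-- **(O3') Countable version (the crux's residual class proper, `descentPerfectToAll_iff_countable`).**
There is a COUNTABLE subfield `K₀ ≤ 𝔽ₚ((X))` and `s ∈ K₀` (with `X ∈ K₀`) such that no extension of
`K₀` in which `X` stays a non-`p`-th power is exhausted at `{X, s}`. Proof (memo §3): take `K₀`
`X`-digit-closed containing `X, s` (`exists_countable_digitClosed_subfield_laurentSeries`); digit
expansions being unique in `𝔽ₚ((X))`, a subfield of `K₀` is digit-closed in `K₀` iff it is in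
`𝔽ₚ((X))`, so the hull of `s` computed in `K₀` is the one computed in `𝔽ₚ((X))`; apply (O1) to `K₀`. -/
theorem exists_countable_no_separable_exhausted_extension :
    ∃ (K₀ : Subfield ((ZMod p)⸨X⸩)) (t s : K₀), Countable K₀ ∧
      (t : (ZMod p)⸨X⸩) = HahnSeries.single (1 : ℤ) (1 : ZMod p) ∧
      ∀ (L : Type) [Field L] [CharP L p] (ι : K₀ →+* L), (∀ z : L, z ^ p ≠ ι t) →
        ¬ ExhaustedAt p L {ι t, ι s} := by
  sorry

/-- **(O5) Tame residual fields exist — the MODULAR residual field (memo §7).** For every prime `p`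
there is `s ∈ 𝔽ₚ[[X]]`, transcendental over `𝔽ₚ(X)`, whose `X`-digit hull has transcendence degree exactly `2`
over `𝔽ₚ` (so (O1) is silent for the countable, `p`-rank-1, non-exhausted field `digitHull p X s`).
Witness: `s =` the reduction mod `p` of the `q`-expansion of an integral-weight modular form with `p`-integral
coefficients that is transcendental mod `p` — `Δ mod 2 = ∑ q^{(2m+1)²}` for `p = 2`, `θ₃⁴ mod p` for odd `p`
(squares are not `k`-automatic for any `k` [Minsky–Papert; Allouche–Shallit Cor. 8.6.5] + Christol). Proof
that the hull is small: Katz's ring `𝓥 ⊆ 𝔽ₚ[[q]]` of mod-`p` reductions of `p`-adic modular forms of tame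
level `N` is a domain of transcendence degree `1` (functions on the Igusa tower, ind-étale over the ordinary
locus; `q`-expansion principle), is stable under `θ = q d/dq` [Katz, LNM 601] and under restriction of
`q`-expansions to residue classes `n ≡ R (mod pᵐ)` (twist-and-average over `ℤₚ[ζ_{pᵐ}]`, saturation of `𝓥` by
the `q`-expansion principle); every level-`m` decimation `Λ⁽ᵐ⁾_R s` satisfies
`(Λ⁽ᵐ⁾_R s)^{pᵐ} = q^{-R} · ∑_{n ≡ R (pᵐ)} aₙ qⁿ ∈ q^{-R} 𝓥`, hence is algebraic over `𝔽ₚ(q, 𝓥)`, a field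
of transcendence degree `2`. ∎ (sorried; Mathlib has neither Christol nor Katz.) -/
theorem exists_laurentSeries_tame_digitHull :
    ∃ s : (ZMod p)⸨X⸩,
      AlgebraicIndependent (ZMod p) ![HahnSeries.single (1 : ℤ) (1 : ZMod p), s] ∧
      ∀ v : Fin 3 → (ZMod p)⸨X⸩,
        (∀ i, v i ∈ digitHull p (HahnSeries.single (1 : ℤ) (1 : ZMod p)) s) →
          ¬ AlgebraicIndependent (ZMod p) v := by
  sorry

/-- **(O6) Absoluteness of residualness in `p`-rank one (memo §7b) — answers Q-env-tame: NO.**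
Let `K = Kᵖ(t)` (`hK`: every element has a `t`-digit expansion in `K`), `ι t ∉ Lᵖ`, and let `t, s` be
algebraically independent over every perfect subfield of `K` (equivalently over the maximal perfect subfield
`⋂ₙ K^{pⁿ}`; for subfields of `𝔽ₚ((t))` this just says `s ∉ 𝔽ₚ(t)^{alg}`). Then NO extension `L` in which `t`
stays a non-`p`-th power is EFT-separably exhausted at `{ι t, ι s}`. No genericity of digits is needed: this
supersedes (O1) whenever `K` has `p`-rank one, and it covers the tame modular residual field of (O5).
Proof (Hasse–Schmidt «no new constants»): an exhausting level gives `ι(hull) ⊆ E₁ ⊆ M'' := (k₂(ιt))^{sep}` with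
`k₂` perfect (as in O1, Steps 1–3); `M''` and `ι(hull)` both have `p`-basis `{ιt}`, so the unique higher
derivation `E_T : q ↦ q + T` of `M''` (Matsumura §27, Thm 27.2) restricts to the hull (digit formula
`Dₙx = ∑ᵢ C(i,n) q^{i-n} x_i^{p^m}`); elements of `k₂` are `E_T`-constants, the constants of the hull are
`⋂ hull^{pⁿ} ⊆ ⋂ K^{pⁿ}`; Kolchin's argument (apply `E_T` to a shortest `hull`-linear relation among elements
of `k₂`) makes `ι(hull)` and `k₂` linearly disjoint over a field over which `t, s` are still algebraically
independent, whence `trdeg_{k₂}(k₂·ι(hull)) ≥ 2 > 1 = trdeg_{k₂} M''`. ∎ (sorried.) -/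
theorem not_exhaustedAt_extension_of_pRankOne {K L : Type} [Field K] [Field L] [CharP K p] [CharP L p]
    (ι : K →+* L) (t s : K)
    (hK : ∀ x : K, ∃ d : Fin p → K, x = ∑ i : Fin p, t ^ (i : ℕ) * d i ^ p)
    (ht : ∀ z : L, z ^ p ≠ ι t)
    (hs : ∀ C : Subfield K, (∀ x ∈ C, ∃ y ∈ C, y ^ p = x) →
      AlgebraicIndependent C ![t, s]) :
    ¬ ExhaustedAt p L {ι t, ι s} := by
  sorry

/-- **(O6') Corollary for the flagship field, superseding (O3): ANY `s ∈ 𝔽ₚ((X))` transcendental over `𝔽ₚ(X)`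
works** — `𝔽ₚ((X)) = 𝔽ₚ((X))ᵖ(X)` and `⋂ₙ 𝔽ₚ((X))^{pⁿ} = 𝔽ₚ`, so (O6) applies; the same holds verbatim for
every digit-closed subfield `K₀ ∋ X, s` (e.g. the modular residual field of (O5) and the `Countable` witness of
the tree). (sorried; follows from O6 plus the two structural facts about Laurent series.) -/
theorem laurentSeries_no_separable_exhausted_extension_of_transcendental (s : (ZMod p)⸨X⸩)
    (hs : AlgebraicIndependent (ZMod p) ![HahnSeries.single (1 : ℤ) (1 : ZMod p), s]) :
    ∀ (L : Type) [Field L] [CharP L p] (ι : (ZMod p)⸨X⸩ →+* L),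
      (∀ z : L, z ^ p ≠ ι (HahnSeries.single (1 : ℤ) (1 : ZMod p))) →
        ¬ ExhaustedAt p L {ι (HahnSeries.single (1 : ℤ) (1 : ZMod p)), ι s} := by
  sorry

/-- **(O4) EC-rigidity (the «tame» complement).** Let `ι : K →+* L`, `t ∉ Lᵖ`, `[L : Lᵖ] ≤ p` (so
`L = Lᵖ(ι t)`), and let `K` be EXISTENTIALLY CLOSED in `L` for homogeneous Frobenius-linear systems
(`∑ᵢ cᵢ yᵢ^{pⁿ} = 0` with coefficients from `K`: a non-zero solution in `L` gives one in `K`) — e.g. `L`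
an ultrapower of `K`, or any `L` with `K ≼_∃ L`. If `L` is exhausted at `{ι t, ι s}` then `t, s` satisfy a
non-zero polynomial relation whose coefficients lie in the perfect core `⋂ₙ K^{pⁿ}`; since `t ∉ Kᵖ` is
transcendental over that perfect field, `s` is algebraic over `K^{p^∞}(t)`, i.e. `K ⊇ 𝔽ₚ(t,s)` is then
already in the tree's class `T` locally (`exhaustedByEssFiniteType_iff_trdeg_le_of_pRank`).

Proof (memo §4). `E` f.g. over perfect `k₀` with `L/E` separable has `p`-basis of size `≤ 1`, `= {ι t}`,
so `trdeg(E/k₀) = 1` and `ι s` is algebraic over `k₀(ι t)`: `∑ π_{ab} (ι t)ᵃ (ι s)ᵇ = 0`, `π ≠ 0`,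
`π_{ab} ∈ k₀ ⊆ L^{pⁿ}` for all `n`. Existential closedness transports, for each `n`, a non-zero relation
of the same bidegree box with coefficients in `K^{pⁿ}`. The `K`-spans `Uₙ` of the relation spaces
`Vₙ ⊆ (K^{pⁿ})^{box}` decrease and stabilise at some `U ≠ 0`; `U` is `K^{pⁿ}`-rational for all large
`n`, so its reduced-echelon basis has entries in `⋂ₙ K^{pⁿ}` and lies in every `Vₙ`. ∎ -/
theorem relation_over_perfectCore_of_existentiallyClosed
    {K L : Type} [Field K] [Field L] [CharP K p] [CharP L p]
    (ι : K →+* L) (t s : K) (ht : ∀ z : L, z ^ p ≠ ι t)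
    (hL : ∀ (n : ℕ) (v : Fin n → L), LinearIndependent (frobenius L p).fieldRange v → n ≤ p)
    (hec : ∀ (n m : ℕ) (c : Fin m → K),
      (∃ y : Fin m → L, y ≠ 0 ∧ ∑ i, ι (c i) * y i ^ p ^ n = 0) →
        ∃ y : Fin m → K, y ≠ 0 ∧ ∑ i, c i * y i ^ p ^ n = 0)
    (hex : ExhaustedAt p L {ι t, ι s}) :
    ∃ P : MvPolynomial (Fin 2) K, P ≠ 0 ∧ MvPolynomial.eval ![t, s] P = 0 ∧
      ∀ m ∈ P.support, ∀ n : ℕ, ∃ y : K, y ^ p ^ n = P.coeff m := by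
  sorry


end Summit.ResolutionOfSingularities.ResolutionOfSingularities.Cruxes.DescentPerfectToAll.Lens4NoSeparableEnvelope
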